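import Literature.Topology.FourManifolds.SurfaceGroupNotProjective
import HarnessLib

/-!
# Lifting a pair of characters of a surface group to the extraspecial group of order `p³`

Topic `Literature/GroupTheory/CombinatorialGroupTheory`.  For the orientable surface group
`S_h = ⟨a₁, b₁, …, a_h, b_h ∣ ∏ᵢ [aᵢ, bᵢ]⟩` (the tree's `Literature.Topology.FourManifolds.SurfaceGroup h`)
and a prime `p`, a homomorphism `Φ : S_h → 𝔽_p × 𝔽_p` (written multiplicatively,
`Multiplicative (ZMod p) × Multiplicative (ZMod p)`), i.e. a pair of characters `(Φ₁, Φ₂)`, has the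
**Heisenberg obstruction**
`ω(Φ) = ∑ᵢ (Φ₁(aᵢ) Φ₂(bᵢ) - Φ₂(aᵢ) Φ₁(bᵢ)) ∈ 𝔽_p`
(the cup product `Φ₁ ∪ Φ₂` evaluated on the fundamental class; K. S. Brown, *Cohomology of Groups*,
IV §3 for the extension class, and the computation `F(∏ᵢ[aᵢ,bᵢ]) = ι(∑ᵢ …)` of the tree's
`SurfaceGroupNotProjective.lean`, which is the special case `Φ =` abelianisation mod `p`).  PROVED here
(theorems only, no definitions; `ω` is always written out):

* `exists_extraspecial_lift` — there is a finite group `E` with a homomorphism `α : E → 𝔽_p × 𝔽_p`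
  (the extraspecial group of order `p³` and exponent `p` for odd `p`, `D₄ ≅ E` for `p = 2`: the
  extension `E_B` of `𝔽_p²` by `𝔽_p` with bilinear cocycle `B(u, v) = u₁ v₂`, an instance of the tree's
  `CocycleExtension`) in which NO lift of `(1,0)` commutes with a lift of `(0,1)`, and through which
  EVERY `Φ : S_h → 𝔽_p²` with `ω(Φ) = 0` lifts: `α ∘ θ = Φ` (define `θ` on the generators by the
  set-theoretic section; the relator goes to `ι(ω(Φ)) = 1`).
* `SurfaceGroup.exists_abelianizationModP` — the mod-`p` abelianisation `S_h ↠ 𝔽_p^{2h}`,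
  `aᵢ ↦ e_{aᵢ}`, `bᵢ ↦ e_{bᵢ}`, is a surjective homomorphism.

These are the finite-group inputs of the orientable-surface-group half of [IUTchI] Lemma 2.7 (v)
(abc-iut-L5-t17, `Literature/IUT/HodgeTheaters/ProfiniteCompletionSurfaceBasisCharacters.lean`), where
the `cd_l`-sentence of Mochizuki's proof (kurims p. 59) is replaced by: pass to an index-`p` subgroup on
which `ω` vanishes, lift to `E`, and observe that commuting elements cannot lift `(1,0)`, `(0,1)`.
-/

noncomputable section

namespace Literature.GroupTheory.CombinatorialGroupTheory

open Literature.Topology.FourManifolds Literature.Algebra.Homology Multiplicative groupCohomology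

/-! ### The mod-`p` abelianisation of a surface group -/

/-- **The mod-`p` abelianisation** `S_h ↠ 𝔽_p^{2h}` (`aᵢ ↦ e_{aᵢ}`, `bᵢ ↦ e_{bᵢ}`; `2h` basis vectors
indexed by `surfaceGen h = Fin h × Bool`) is a surjective homomorphism taking the generator `x` to the
basis vector `e_x`. [cite: HatcherAT2002, §1.2 p. 51] -/
theorem SurfaceGroup.exists_abelianizationModP (h p : ℕ) [NeZero p] :
    ∃ π : SurfaceGroup h →* Multiplicative (surfaceGen h → ZMod p),
      Function.Surjective π ∧ ∀ x : surfaceGen h, π (PresentedGroup.of x) = ofAdd (Pi.single x 1) := by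
  classical
  let π : SurfaceGroup h →* Multiplicative (surfaceGen h → ZMod p) :=
    SurfaceGroup.toCommGroup fun x => ofAdd (Pi.single x 1)
  have hπ : ∀ x : surfaceGen h, π (PresentedGroup.of x) = ofAdd (Pi.single x 1) := fun x =>
    SurfaceGroup.toCommGroup_of _ x
  refine ⟨π, ?_, hπ⟩
  -- every `v` is `∏ₓ π(x)^{v x}` (product over a list of the generators)
  have hlist : ∀ (L : List (surfaceGen h)) (a : surfaceGen h → (surfaceGen h → ZMod p)),
      (L.map fun x => ofAdd (a x)).prod = ofAdd (L.map a).sum := by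
    intro L a
    induction L with
    | nil => simp
    | cons x L ih => rw [List.map_cons, List.prod_cons, List.map_cons, List.sum_cons, ofAdd_add, ih]
  intro v
  refine ⟨((Finset.univ : Finset (surfaceGen h)).toList.map
    fun x => PresentedGroup.of x ^ (toAdd v x).val).prod, ?_⟩
  rw [map_list_prod, List.map_map]
  have hfun : (⇑π ∘ fun x => PresentedGroup.of x ^ (toAdd v x).val) =
      fun x => ofAdd ((toAdd v x).val • Pi.single x (1 : ZMod p)) := by
    funext x
    rw [Function.comp_apply, map_pow, hπ, ofAdd_nsmul]
  rw [hfun, hlist, Finset.sum_map_toList]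
  have hsum : ∑ x : surfaceGen h, (toAdd v x).val • Pi.single x (1 : ZMod p) = toAdd v := by
    ext y
    rw [Finset.sum_apply, Finset.sum_eq_single_of_mem y (Finset.mem_univ y)]
    · rw [Pi.smul_apply, Pi.single_eq_same, nsmul_eq_mul, mul_one, ZMod.natCast_zmod_val]
    · intro x _ hxy
      rw [Pi.smul_apply, Pi.single_apply, if_neg (fun e => hxy e.symm), smul_zero]
  rw [hsum, ofAdd_toAdd]

/-! ### The extraspecial group of order `p³` and the lifting of pairs of characters -/

/-- **The extraspecial lift.**  For a prime `p` there are a finite group `E` and a homomorphism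
`α : E → 𝔽_p × 𝔽_p` (namely the central extension of `𝔽_p²` by `𝔽_p` with bilinear cocycle
`B(u, v) = u₁ v₂`, an instance of the tree's `CocycleExtension`; `α` = the projection) such that
(1) no lift of `(1, 0)` commutes with a lift of `(0, 1)` (their commutator is the central generator
`ι(1)`), and (2) for every genus `h` and every `Φ : S_h → 𝔽_p × 𝔽_p` whose Heisenberg obstruction
`ω(Φ) = ∑ᵢ (Φ₁(aᵢ) Φ₂(bᵢ) - Φ₂(aᵢ) Φ₁(bᵢ))` VANISHES, `Φ` lifts through `α`: the images of the generators
under the set-theoretic section `v ↦ (0, v)` satisfy the surface relation, because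
`∏ᵢ [(0, Φ aᵢ), (0, Φ bᵢ)] = ι(ω(Φ))` (`CocycleExtension.commutator_eq_inl_of_trivial`).
[cite: Brown1982CohomologyGroups, IV §3 (3.3)–(3.5)] -/
theorem exists_extraspecial_lift (p : ℕ) [hp : Fact p.Prime] :
    ∃ (E : Type) (_ : Group E) (_ : Finite E)
      (α : E →* Multiplicative (ZMod p) × Multiplicative (ZMod p)),
      (∀ x y : E, α x = (ofAdd 1, 1) → α y = (1, ofAdd 1) → x * y ≠ y * x) ∧
      ∀ (h : ℕ) (Φ : SurfaceGroup h →* Multiplicative (ZMod p) × Multiplicative (ZMod p)),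
        (∑ i : Fin h, ((toAdd (Φ (SurfaceGroup.a i)).1) * (toAdd (Φ (SurfaceGroup.b i)).2) -
            (toAdd (Φ (SurfaceGroup.a i)).2) * (toAdd (Φ (SurfaceGroup.b i)).1))) = 0 →
        ∃ θ : SurfaceGroup h →* E, ∀ s, α (θ s) = Φ s := by
  classical
  haveI : NeZero p := ⟨hp.out.ne_zero⟩
  -- the bilinear cocycle `B(u, v) = u₁ v₂` on `V = 𝔽_p × 𝔽_p`
  let B : (ZMod p × ZMod p) →+ (ZMod p × ZMod p) →+ ZMod p :=
    { toFun := fun u =>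
        { toFun := fun v => u.1 * v.2
          map_zero' := by simp
          map_add' := fun v v' => by simp only [Prod.snd_add, mul_add] }
      map_zero' := AddMonoidHom.ext fun v => by simp
      map_add' := fun u u' => AddMonoidHom.ext fun v => by
        simp only [AddMonoidHom.coe_mk, ZeroHom.coe_mk, AddMonoidHom.add_apply, Prod.fst_add, add_mul] }
  have hB : ∀ u v : ZMod p × ZMod p, B u v = u.1 * v.2 := fun u v => rfl
  obtain ⟨f, hf⟩ := exists_cocycles₂_of_biadditive B
  haveI : Finite (Rep.trivial (ZMod p) (Multiplicative (ZMod p × ZMod p)) (ZMod p)) :=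
    inferInstanceAs (Finite (ZMod p))
  -- `α : E_f → V → 𝔽_p × 𝔽_p` (coordinates)
  let cf : Multiplicative (ZMod p × ZMod p) →* Multiplicative (ZMod p) × Multiplicative (ZMod p) :=
    ((AddMonoidHom.fst (ZMod p) (ZMod p)).toMultiplicative).prod
      ((AddMonoidHom.snd (ZMod p) (ZMod p)).toMultiplicative)
  have hcf : ∀ v : Multiplicative (ZMod p × ZMod p),
      cf v = (ofAdd (toAdd v).1, ofAdd (toAdd v).2) := fun v => rfl
  let α : CocycleExtension f →* Multiplicative (ZMod p) × Multiplicative (ZMod p) :=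
    cf.comp (CocycleExtension.rightHom f)
  have hα : ∀ x : CocycleExtension f, α x = (ofAdd (toAdd x.right).1, ofAdd (toAdd x.right).2) :=
    fun x => rfl
  -- commutators of lifts
  have hcomm : ∀ x y : CocycleExtension f, x * y * x⁻¹ * y⁻¹ =
      CocycleExtension.inl f (ofAdd ((toAdd x.right).1 * (toAdd y.right).2 -
        (toAdd y.right).1 * (toAdd x.right).2)) := fun x y => by
    rw [CocycleExtension.commutator_eq_inl_of_trivial f x y (Commute.all _ _), hf, hf, hB, hB]
  refine ⟨CocycleExtension f, inferInstance, inferInstance, α, ?_, ?_⟩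
  · -- (1) no commuting lifts of the basis
    intro x y hx hy hxy
    rw [hα, Prod.mk.injEq] at hx hy
    have hx1 : (toAdd x.right).1 = 1 := by simpa using congrArg toAdd hx.1
    have hx2 : (toAdd x.right).2 = 0 := by simpa using congrArg toAdd hx.2
    have hy1 : (toAdd y.right).1 = 0 := by simpa using congrArg toAdd hy.1
    have hy2 : (toAdd y.right).2 = 1 := by simpa using congrArg toAdd hy.2
    have hc := hcomm x y
    rw [hx1, hx2, hy1, hy2, mul_one, mul_zero, sub_zero, hxy, mul_inv_cancel_right,
      mul_inv_cancel] at hc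
    have h1 : CocycleExtension.inl f (ofAdd (1 : ZMod p)) = CocycleExtension.inl f 1 := by
      rw [(CocycleExtension.inl f).map_one]; exact hc.symm
    have h2 := CocycleExtension.inl_injective f h1
    rw [ofAdd_eq_one] at h2
    exact one_ne_zero h2
  · -- (2) lifting when `ω(Φ) = 0`
    intro h Φ hω
    -- the candidate images of the generators
    let F : surfaceGen h → CocycleExtension f := fun x =>
      ⟨0, ofAdd (toAdd (Φ (PresentedGroup.of x)).1, toAdd (Φ (PresentedGroup.of x)).2)⟩
    have hFr : ∀ x, (F x).right =
        ofAdd (toAdd (Φ (PresentedGroup.of x)).1, toAdd (Φ (PresentedGroup.of x)).2) := fun x => rfl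
    -- the relator goes to `ι(ω(Φ)) = 1`
    have hrel : ∀ r ∈ ({surfaceRelator h} : Set (FreeGroup (surfaceGen h))),
        FreeGroup.lift F r = 1 := by
      intro r hr
      rw [Set.mem_singleton_iff] at hr
      subst hr
      rw [surfaceRelator, map_list_prod, List.map_map]
      -- the `i`-th commutator is the central element `ι(Φ₁(aᵢ)Φ₂(bᵢ) - Φ₂(aᵢ)Φ₁(bᵢ))`
      let c : Fin h → ZMod p := fun i =>
        (toAdd (Φ (PresentedGroup.of (i, false))).1) * (toAdd (Φ (PresentedGroup.of (i, true))).2) -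
          (toAdd (Φ (PresentedGroup.of (i, false))).2) * (toAdd (Φ (PresentedGroup.of (i, true))).1)
      have hterm : ∀ i : Fin h,
          (FreeGroup.lift F ∘ fun i => genA i * genB i * (genA i)⁻¹ * (genB i)⁻¹) i =
            CocycleExtension.inl f (ofAdd (c i)) := by
        intro i
        simp only [Function.comp_apply, map_mul, map_inv, genA, genB, FreeGroup.lift_apply_of]
        rw [hcomm, hFr, hFr, toAdd_ofAdd, toAdd_ofAdd]
        change _ = CocycleExtension.inl f (ofAdd
          ((toAdd (Φ (PresentedGroup.of (i, false))).1) * (toAdd (Φ (PresentedGroup.of (i, true))).2) -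
          (toAdd (Φ (PresentedGroup.of (i, false))).2) * (toAdd (Φ (PresentedGroup.of (i, true))).1)))
        rw [mul_comm (toAdd (Φ (PresentedGroup.of (i, true))).1)]
      have hlist : ∀ (L : List (Fin h)),
          (L.map fun i => CocycleExtension.inl f (ofAdd (c i))).prod =
            CocycleExtension.inl f (ofAdd (L.map c).sum) := by
        intro L
        induction L with
        | nil => rw [List.map_nil, List.prod_nil, List.map_nil, List.sum_nil, ofAdd_zero, map_one]
        | cons x L ih =>
          rw [List.map_cons, List.prod_cons, List.map_cons, List.sum_cons, ofAdd_add, map_mul, ih]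
      have hω' : ((List.finRange h).map c).sum = 0 := by
        rw [← Fin.sum_univ_def]
        simpa only [SurfaceGroup.a, SurfaceGroup.b] using hω
      rw [List.map_congr_left (fun i _ => hterm i), hlist, hω', ofAdd_zero, map_one]
    refine ⟨PresentedGroup.toGroup hrel, fun s => ?_⟩
    -- `α ∘ θ = Φ`: check on generators
    have hgen : ∀ x : surfaceGen h,
        α (PresentedGroup.toGroup hrel (PresentedGroup.of x)) = Φ (PresentedGroup.of x) := by
      intro x
      rw [PresentedGroup.toGroup.of, hα, hFr, toAdd_ofAdd]
      change (ofAdd (toAdd (Φ (PresentedGroup.of x)).1), ofAdd (toAdd (Φ (PresentedGroup.of x)).2)) = _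
      rw [ofAdd_toAdd, ofAdd_toAdd]
    exact DFunLike.congr_fun (PresentedGroup.ext (φ := α.comp (PresentedGroup.toGroup hrel))
      (ψ := Φ) hgen) s

end Literature.GroupTheory.CombinatorialGroupTheory

end
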